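/-
Copyright: lit-balaban Phase-2 proof seat p02 (gen 11).  Statement-level skeleton of a published paper; no proof claims beyond what
the kernel checks below.
-/
import Literature.MathematicalPhysics.QuantumFieldTheory.BalabanImbrieJaffe1984to88.BIJ88Assoc575Torus
import Literature.MathematicalPhysics.QuantumFieldTheory.BalabanImbrieJaffe1984to88.BIJ88Ineq576Proof
import Literature.MathematicalPhysics.QuantumFieldTheory.BalabanImbrieJaffe1984to88.BIJ88W5Bound549
import Literature.MathematicalPhysics.QuantumFieldTheory.BalabanImbrieJaffe1984to88.BIJ85Ineq722Torus
import Literature.MathematicalPhysics.QuantumFieldTheory.BalabanImbrieJaffe1984to88.BIJ88SmallCoupling23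

/-!
# `BalabanImbrieJaffe1984to88.BIJ88Ineq576Torus` — T. Bałaban, J. Imbrie, A. Jaffe, *Effective action and cluster properties of the
abelian Higgs model*, Commun. Math. Phys. **114** (1988) 257–315 [BalabanImbrieJaffe1988]: **(5.7.6)** p. 290 PROVED ON THE TORUS OF
RECORD — *"where compatible means that b₁, …, b_m, b were associated to X as above. We have |A′(b_l)| ≤ cp(e_k), |w₅(b,b_l)| ≤
e^{−cr(e_k)}e^{−c dist(b,b_l)} and so |w_{b,m}(X)| ≤ e^{−cr(e_k)|X|}. (5.7.6)"* — for r16's CONCRETE localized powers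
`w_{b,m}(X) = BIJ88Sect5StatementsPart4.wbm` of (5.7.5) with the TORUS association `BIJ88Assoc575Torus.assocT` (file 1/2): the polymers
are finite unions of the `r(e_k)`-cubes paving the torus `T^{(j)} = Balaban1983to89.Setup.Site P j` periodically, distances are the `ℓ^∞`
torus distance of record `LatticeFieldCalculus.supDist`, and the lattice sum behind *"and so"* is p20's torus sum
`B3TorusRadialSums.sum_exp_neg_supDist_le`, UNIFORM IN THE VOLUME.

statement-level skeleton of published theorems with citation tags; proofs where landed; nothing here is a claim about the Yang–Mills mass gap

PDF held: `paper:balaban1988-cmp114-bij-abelian-higgs-effective-action` (journal page = PDF page + 256); p. 289 [PDF 33] ll. 35–41, p. 290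
[PDF 34] ll. 2–4 (text layer, this session); p. 283 [PDF 27] ((5.4.9), the kernel `w₅`) as quoted in p08's `BIJ88W5Bound549`.

CITATION HEADER (lean-in-tree rule).  Part of the lit-balaban TYPED SKELETON (HOME `run/shared/lean/pub/lit-balaban/`), Phase 2, seat
p02 (gen 11, unit `lit-balaban-p02`); file 2/2 for row **C2.Eq5.7.5-5.7.6** of `HOME/lit-balaban-r16/ROWS-C2-part2.md` (owner r16:
*"typed p240155 ((5.7.6) leaf) · (5.7.5) `wbm` def + `eq575` proved p245624 · (5.7.6) proved p247565 (p36, model instance: `ineq576_Zd`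
… with the ℤ^d association `assocZd` …)"*).  KIND «model instance ON THE TORI OF RECORD»: p36's `ℤ^d` instance (`BIJ88Ineq576Proof`,
the model of record on `ℤ^d`; its §1 *printed one-line argument for any tight association* `abs_wbm_le_of_tight` is used BY NAME) is
carried to the periodic geometry of `T^{(k)}` itself.  WHAT IS PROVED (theorems only; 0 `sorry`; axioms standard; nothing restated):
* §1 `wbm_assocT_empty` (the empty polymer carries nothing); the lattice sum over BONDS placed on the torus with at most `N_f` per site,
  `Σ_{b′} e^{−c·supDist(x₀, b′)} ≤ N_f(2(1 + d/c))^d` (`sum_exp_neg_supDist_fiber_le_torus`; for the unit bonds `Balaban1983to89.PBond P j` placed at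
  their initial points, `N_f = d`: `card_fiber_src_le`); monotonicity of r16's leaf in the rate, `ineq576_mono_c`.
* §2 **(5.7.6) on the torus**, the print's one-liner with explicit constants: from `|w(b,b′)| ≤ e^{−c₁ℓ}e^{−c₂·supDist(x₀,b′)}`,
  `|A′(b′)| ≤ a`, the lattice sum `Σ_{b′}e^{−(c₃/2)supDist(x₀,b′)} ≤ S`, `c₃ = min(c₁/3, c₂)`, and `r(e_k)` LARGE (`aS ≤ e^{c₁ℓ/4}`), for
  every `m ≥ 1`: `ineq576_torus_of_latticeSum : Ineq576 ⟨Finset (CubeTor P j ℓ), card⟩ (wbm w A′ b m (assocT pos ℓ x₀ m)) c′ ℓ`,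
  **`c′ = min(c₁/4, c₃/(2d))`** (tightness of file 1/2 costs `3d·m·ℓ`, paid by a third of `c₁`); with the torus sum DISCHARGED
  (`S = N_f(2(1 + 2d/c₃))^d`): **`ineq576_torus`**; for the unit bonds of `T^{(j)}` themselves (`pos = Balaban1983to89.PBond.src`, `x₀ = b₋`):
  `ineq576_torus_bonds`.
* §4 THE FINE-LATTICE SOURCE: for `b ∈ T_η` (a fine site `x ∈ Site P 0`) and `b_l ∈ T^{(k)}` (`PBond P k`, placed at their initial points)
  with the distance `distEU P k x b′₋` of the torus files of record (`BIJ85Ineq722Torus.distEU`, as in `BIJ88Ineq547W2Torus`): the `k`-block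
  `x_k` of `x` satisfies `supDist(x_k, y) ≤ distEU(x, y) + ½` (`supDist_blk_le_distEU`), whence from `Ineq547 (Site P 0) (PBond P k) w distEU c r`
  (`r ≥ ℓ`): **`ineq576_torus_fine`** `: Ineq576 … (wbm (fun _ b′ => w x b′) A′ b₀ m (assocT PBond.src ℓ x_k m)) (c/(12d)) ℓ`.
* §5 THE SMALL-COUPLING REGIME: with `ℓ = ⌈r(e_k)⌉`, `|A′| ≤ c_A·p(e_k)` and the kernel bound at every `e_k`, the largeness hypothesis
  holds for `e_k → 0⁺` (p36's `eventually_hlarge576`): **`ineq576_torus_eventually`** (`∀ᶠ e_k ∈ 𝓝[>]0, Ineq576 …`).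
* §3 KNITTING WITH (5.4.9): from r16's one-letter shape `BIJ88Sect5StatementsPart2.Ineq547 β β w dist c r` (p. 290's `|w₅(b,b_l)| ≤
  e^{−cr(e_k)}e^{−c dist(b,b_l)}`, `dist` = torus `supDist` of the positions, `r ≥ ℓ`) to `Ineq576 … (c/(6d)) ℓ` (`ineq576_torus_of_ineq547`),
  and for p08's kernel `w₅ = [(𝒟_k − 𝒟_{k,loc})∂*Q^{e*}_k∂ + H_k − H_{k,loc}]Λ₃^{(k)*}` of (5.4.9) in the kernel ring `Matrix ι ι ℝ` with the
  index set `ι` placed on the torus (`BIJ88W5Bound549.ineq547_w5` BY NAME, its displayed hypotheses verbatim): **`ineq576_torus_w5`**.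
HONEST SCOPE.  (i) As in p36's files the two displayed hypotheses of p. 290 (`|A′| ≤ a = cp(e_k)`, the `w₅` bound) and *"r(e_k) large"*
(`a·S ≤ e^{c₁ℓ/4}`; discharged for `e_k → 0⁺` in §5) enter as hypotheses; in §3
the `w₅` bound is p08's theorem with ITS hypotheses (tail bound of p. 282, locality of `∂*Q^{e*}_k∂`, (2.7), prefactor absorption).
(ii) `ℓ ∈ ℕ` is the cube side in lattice steps (`ℓ = ⌈r(e_k)⌉`; real `r(e_k) ≤ ℓ` by p36's `ineq576_mono_rk`); `m = 0` excluded as in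
print (`n ≥ 1` in `F_{1,j}`).  (iii) r16's `wbm` has ONE bond type; a source bond `b ∈ T_η` of the fine lattice enters through the site `x₀ ∈ T^{(j)}` locating it
(`ineq576_torus_of_latticeSum`, any `x₀`) and, in §4, through the row `b′ ↦ w(x,b′)` of a two-carrier kernel with `x₀ = x_k` (the dummy
index `b₀` of `wbm` is then immaterial).  (iv) The torus-native `𝒟_k`,
`H_k` operators of p31/p08's §5.4–5.5 torus files are NOT instantiated here (the `(𝒟_k − 𝒟_{k,loc})` tail on the tori is p08's pending
chain); NOT summit progress; NOT a claim about any continuum limit.  Unit `lit-balaban-p02` (literature-prover-lit-balaban-p02-g11-0),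
2026-08-22.
-/

namespace Literature.MathematicalPhysics.QuantumFieldTheory.BalabanImbrieJaffe1984to88.BIJ88Ineq576Torus

open Finset
open Literature.MathematicalPhysics.QuantumFieldTheory.Balaban1983to89
open Balaban1983to89.LatticeFieldCalculus (supDist)
open Balaban1983to89.B3TorusRadialSums (sum_exp_neg_supDist_le)
open BIJ88Sect5StatementsPart2 (PolymerSys Ineq576 Ineq547)
open BIJ88Sect5StatementsPart4 (wbm)
open BIJ88Ineq576Proof (abs_wbm_le_of_tight)
open BIJ88Assoc575Torus

noncomputable section

/-! ## §1 Bookkeeping: the empty polymer, the torus lattice sum over bonds, monotonicity in the rate -/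

section Bookkeeping

variable {P : Params} {j : ℕ} {β : Type*} [Fintype β]

/-- the fibres of the torus association are never the empty polymer: `w_{b,m}(∅) = 0`. [cite: BalabanImbrieJaffe1988, (5.7.5) p.289] -/
theorem wbm_assocT_empty (pos : β → Balaban1983to89.Site P j) (ℓ : ℕ) (x₀ : Balaban1983to89.Site P j) (w : β → β → ℝ) (A' : β → ℝ) (b : β) (m : ℕ) :
    wbm w A' b m (assocT pos ℓ x₀ m) ∅ = 0 := by
  classical
  unfold wbm
  refine Finset.sum_eq_zero fun t ht => ?_
  exact absurd (Finset.mem_filter.mp ht).2 (assocT_ne_empty pos ℓ x₀ m t)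

/-- **BONDS ON THE TORUS**: for bonds placed on `T^{(j)}` by `pos` with at most `N_f` bonds per site,
`Σ_{b′} e^{−c·supDist(x₀, pos b′)} ≤ N_f(2(1 + d/c))^d` — fibrewise over p20's torus sum, uniform in the volume.
[cite: BalabanImbrieJaffe1988, (5.7.6) p.290] -/
theorem sum_exp_neg_supDist_fiber_le_torus [DecidableEq β] (pos : β → Balaban1983to89.Site P j) (Nf : ℕ)
    (hN : ∀ y, (Finset.univ.filter fun b' => pos b' = y).card ≤ Nf) {c : ℝ} (hc : 0 < c) (x₀ : Balaban1983to89.Site P j) :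
    ∑ b', Real.exp (-(c * (supDist x₀ (pos b') : ℝ))) ≤ Nf * (2 * (1 + P.d / c)) ^ P.d := by
  classical
  have hd : 0 < P.d := lt_of_lt_of_le Nat.zero_lt_one P.hd
  rw [Finset.sum_comp (s := Finset.univ) (f := fun y => Real.exp (-(c * (supDist x₀ y : ℝ)))) (g := pos)]
  calc ∑ y ∈ Finset.univ.image pos, (Finset.univ.filter fun b' => pos b' = y).card • Real.exp (-(c * (supDist x₀ y : ℝ)))
      ≤ ∑ y ∈ Finset.univ.image pos, (Nf : ℝ) * Real.exp (-(c * (supDist x₀ y : ℝ))) := by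
        refine Finset.sum_le_sum fun y _ => ?_
        rw [nsmul_eq_mul]
        exact mul_le_mul_of_nonneg_right (by exact_mod_cast hN y) (Real.exp_pos _).le
    _ = Nf * ∑ y ∈ Finset.univ.image pos, Real.exp (-(c * (supDist x₀ y : ℝ))) := by rw [Finset.mul_sum]
    _ ≤ Nf * ∑ y : Balaban1983to89.Site P j, Real.exp (-(c * (supDist x₀ y : ℝ))) :=
        mul_le_mul_of_nonneg_left
          (Finset.sum_le_sum_of_subset_of_nonneg (Finset.subset_univ _) fun y _ _ => (Real.exp_pos _).le) (Nat.cast_nonneg Nf)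
    _ ≤ Nf * (2 * (1 + P.d / c)) ^ P.d := mul_le_mul_of_nonneg_left (sum_exp_neg_supDist_le hc hd x₀) (Nat.cast_nonneg Nf)

/-- the unit bonds of `T^{(j)}` placed at their initial points: exactly `d` bonds per site (one per direction), so `N_f = d`.
[cite: BalabanImbrieJaffe1988, (5.7.6) p.290] -/
theorem card_fiber_src_le (y : Balaban1983to89.Site P j) : (Finset.univ.filter fun b' : Balaban1983to89.PBond P j => b'.src = y).card ≤ P.d := by
  classical
  calc (Finset.univ.filter fun b' : Balaban1983to89.PBond P j => b'.src = y).card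
      ≤ ((Finset.univ : Finset (Fin P.d)).image fun μ => (⟨y, μ⟩ : Balaban1983to89.PBond P j)).card := by
        refine Finset.card_le_card fun b' hb' => ?_
        have h : b'.src = y := (Finset.mem_filter.mp hb').2
        exact Finset.mem_image.mpr ⟨b'.dir, Finset.mem_univ _, by cases b'; cases h; rfl⟩
    _ ≤ (Finset.univ : Finset (Fin P.d)).card := Finset.card_image_le
    _ = P.d := by rw [Finset.card_univ, Fintype.card_fin]

/-- r16's leaf is monotone in the rate: `Ineq576 P w c rk → Ineq576 P w c′ rk` for `c′ ≤ c`, `rk ≥ 0`.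
[cite: BalabanImbrieJaffe1988, (5.7.6) p.290] -/
theorem ineq576_mono_c (Q : PolymerSys) (w : Q.Poly → ℝ) {c c' rk : ℝ} (hc : c' ≤ c) (hrk : 0 ≤ rk)
    (h : Ineq576 Q w c rk) : Ineq576 Q w c' rk := by
  intro X
  refine (h X).trans (Real.exp_le_exp.mpr ?_)
  have : 0 ≤ rk * (Q.card X : ℝ) := mul_nonneg hrk (Nat.cast_nonneg _)
  nlinarith

end Bookkeeping

/-! ## §2 (5.7.6) for the torus association -/

section Torus

variable {P : Params} {j : ℕ} {β : Type*} [Fintype β]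

/-- **(5.7.6) for the torus association, lattice sum as a hypothesis** (the print's one-liner with explicit constants): bonds
placed on `T^{(j)}` by `pos`, `r(e_k)`-cubes of side `ℓ ≥ 1` paving the torus, `x₀` the site locating `b`,
`|w(b,b′)| ≤ e^{−c₁ℓ}e^{−c₂·supDist(x₀,b′)}`, `|A′(b′)| ≤ a`, `Σ_{b′} e^{−(c₃/2)·supDist(x₀,b′)} ≤ S` with `c₃ = min(c₁/3, c₂)`, and `r(e_k)`
large: `aS ≤ e^{c₁ℓ/4}`.  Then for every `m ≥ 1`, `|w_{b,m}(X)| ≤ e^{−c′ℓ|X|}` for ALL polymers `X` of the cube torus,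
`c′ = min(c₁/4, c₃/(2d))`. [cite: BalabanImbrieJaffe1988, (5.7.6) p.290] -/
theorem ineq576_torus_of_latticeSum (pos : β → Balaban1983to89.Site P j) {ℓ : ℕ} (hℓ : 0 < ℓ) (x₀ : Balaban1983to89.Site P j) (w : β → β → ℝ)
    (A' : β → ℝ) (b : β) {m : ℕ} (hm : 1 ≤ m) {c₁ c₂ a S : ℝ} (hc₁ : 0 < c₁) (hc₂ : 0 < c₂)
    (hw : ∀ b', |w b b'| ≤ Real.exp (-(c₁ * ℓ)) * Real.exp (-(c₂ * (supDist x₀ (pos b') : ℝ))))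
    (hA : ∀ b', |A' b'| ≤ a)
    (hS : ∑ b', Real.exp (-(min (c₁ / 3) c₂ / 2 * (supDist x₀ (pos b') : ℝ))) ≤ S)
    (hlarge : a * S ≤ Real.exp (c₁ * ℓ / 4)) :
    Ineq576 ⟨Finset (CubeTor P j ℓ), Finset.card⟩ (wbm w A' b m (assocT pos ℓ x₀ m))
      (min (c₁ / 4) (min (c₁ / 3) c₂ / (2 * P.d))) ℓ := by
  classical
  intro X
  set c₃ : ℝ := min (c₁ / 3) c₂ with hc₃def
  have hc₃pos : 0 < c₃ := lt_min (by linarith) hc₂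
  have hc₃c₁ : c₃ ≤ c₁ / 3 := min_le_left _ _
  have hc₃c₂ : c₃ ≤ c₂ := min_le_right _ _
  have hd : 0 < P.d := lt_of_lt_of_le Nat.zero_lt_one P.hd
  have hdpos : (0 : ℝ) < P.d := by exact_mod_cast hd
  have hℓpos : (0 : ℝ) < ℓ := by exact_mod_cast hℓ
  have ha : 0 ≤ a := (abs_nonneg _).trans (hA b)
  -- the empty polymer
  by_cases hX : X = ∅
  · subst hX
    show |wbm w A' b m (assocT pos ℓ x₀ m) ∅| ≤ _
    rw [wbm_assocT_empty, abs_zero]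
    exact (Real.exp_pos _).le
  have hcard : (1 : ℝ) ≤ (X.card : ℝ) := by
    exact_mod_cast Finset.card_pos.mpr (Finset.nonempty_iff_ne_empty.mpr hX)
  -- the kernel bound with the weaker rate c₃ ≤ c₂
  have hw' : ∀ b', |w b b'| ≤ Real.exp (-(c₁ * ℓ)) * Real.exp (-(c₃ * (supDist x₀ (pos b') : ℝ))) := by
    intro b'
    refine (hw b').trans (mul_le_mul_of_nonneg_left ?_ (Real.exp_pos _).le)
    exact Real.exp_le_exp.mpr (neg_le_neg (mul_le_mul_of_nonneg_right hc₃c₂ (Nat.cast_nonneg _)))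
  -- tightness of the torus association, as a lower bound on the total distance on the fibre of X
  have htight : ∀ t : Fin m → β, assocT pos ℓ x₀ m t = X →
      (ℓ / P.d * ((X.card : ℝ) - 1) - 3 * m * ℓ) ≤ ∑ l, (supDist x₀ (pos (t l)) : ℝ) := by
    intro t ht
    have h := tight_assocT pos hℓ x₀ m t
    rw [ht] at h
    rw [div_mul_eq_mul_div, sub_le_iff_le_add, div_le_iff₀ hdpos]
    nlinarith
  -- the printed argument (p36's §1, by name)
  have hcore := abs_wbm_le_of_tight w A' b m (assocT pos ℓ x₀ m) X (Real.exp_pos _).le hc₃pos.le hw' hA hS htight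
  refine hcore.trans ?_
  show Real.exp (-(c₃ / 2 * (ℓ / P.d * ((X.card : ℝ) - 1) - 3 * m * ℓ))) * (a * Real.exp (-(c₁ * ℓ)) * S) ^ m
    ≤ Real.exp (-(min (c₁ / 4) (c₃ / (2 * P.d)) * ℓ) * (X.card : ℝ))
  have hm' : (1 : ℝ) ≤ m := by exact_mod_cast hm
  -- (a e^{-c₁ℓ} S)^m ≤ e^{-(3/4) c₁ ℓ m}
  have hbase : a * Real.exp (-(c₁ * ℓ)) * S ≤ Real.exp (-(3 / 4 * c₁ * ℓ)) := by
    have h1 : a * Real.exp (-(c₁ * ℓ)) * S = (a * S) * Real.exp (-(c₁ * ℓ)) := by ring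
    rw [h1]
    calc a * S * Real.exp (-(c₁ * ℓ)) ≤ Real.exp (c₁ * ℓ / 4) * Real.exp (-(c₁ * ℓ)) :=
          mul_le_mul_of_nonneg_right hlarge (Real.exp_pos _).le
      _ = Real.exp (-(3 / 4 * c₁ * ℓ)) := by rw [← Real.exp_add]; congr 1; ring
  have hbase0 : 0 ≤ a * Real.exp (-(c₁ * ℓ)) * S := by
    have hS0 : 0 ≤ S := le_trans (Finset.sum_nonneg fun _ _ => (Real.exp_pos _).le) hS
    positivity
  have hpow : (a * Real.exp (-(c₁ * ℓ)) * S) ^ m ≤ Real.exp (-(3 / 4 * c₁ * ℓ * m)) := by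
    calc (a * Real.exp (-(c₁ * ℓ)) * S) ^ m ≤ Real.exp (-(3 / 4 * c₁ * ℓ)) ^ m :=
          pow_le_pow_left₀ hbase0 hbase m
      _ = Real.exp (-(3 / 4 * c₁ * ℓ * m)) := by rw [← Real.exp_nat_mul]; congr 1; ring
  calc Real.exp (-(c₃ / 2 * (ℓ / P.d * ((X.card : ℝ) - 1) - 3 * m * ℓ))) * (a * Real.exp (-(c₁ * ℓ)) * S) ^ m
      ≤ Real.exp (-(c₃ / 2 * (ℓ / P.d * ((X.card : ℝ) - 1) - 3 * m * ℓ))) * Real.exp (-(3 / 4 * c₁ * ℓ * m)) :=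
        mul_le_mul_of_nonneg_left hpow (Real.exp_pos _).le
    _ ≤ Real.exp (-(min (c₁ / 4) (c₃ / (2 * P.d)) * ℓ) * (X.card : ℝ)) := by
        rw [← Real.exp_add, Real.exp_le_exp]
        set A : ℝ := c₃ / (2 * P.d) * ℓ * ((X.card : ℝ) - 1) with hAdef
        have hmin1 : min (c₁ / 4) (c₃ / (2 * P.d)) ≤ c₁ / 4 := min_le_left _ _
        have hmin2 : min (c₁ / 4) (c₃ / (2 * P.d)) ≤ c₃ / (2 * P.d) := min_le_right _ _
        -- c′ℓ|X| ≤ A + (c₁/4)ℓ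
        have hkey : min (c₁ / 4) (c₃ / (2 * P.d)) * ℓ * (X.card : ℝ) ≤ A + c₁ / 4 * ℓ := by
          have h1 : min (c₁ / 4) (c₃ / (2 * P.d)) * ℓ * ((X.card : ℝ) - 1) ≤ c₃ / (2 * P.d) * ℓ * ((X.card : ℝ) - 1) :=
            mul_le_mul_of_nonneg_right (mul_le_mul_of_nonneg_right hmin2 hℓpos.le) (by linarith)
          have h2 : min (c₁ / 4) (c₃ / (2 * P.d)) * ℓ ≤ c₁ / 4 * ℓ := mul_le_mul_of_nonneg_right hmin1 hℓpos.le
          have h3 : min (c₁ / 4) (c₃ / (2 * P.d)) * ℓ * (X.card : ℝ)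
              = min (c₁ / 4) (c₃ / (2 * P.d)) * ℓ * ((X.card : ℝ) - 1) + min (c₁ / 4) (c₃ / (2 * P.d)) * ℓ := by ring
          rw [h3, hAdef]
          linarith
        -- the exponent of the tightness factor, split
        have hexp : c₃ / 2 * (ℓ / P.d * ((X.card : ℝ) - 1) - 3 * m * ℓ) = A - 3 / 2 * c₃ * (m * ℓ) := by
          rw [hAdef]
          field_simp
        -- (3/2) c₃ m ℓ ≤ (c₁/2) m ℓ and c₁ ℓ ≤ c₁ ℓ m
        have h5 : 3 / 2 * c₃ * (m * ℓ) ≤ c₁ / 2 * (m * ℓ) := by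
          have : 3 / 2 * c₃ ≤ c₁ / 2 := by linarith
          exact mul_le_mul_of_nonneg_right this (by positivity)
        have hcm : c₁ * ℓ ≤ c₁ * (m * ℓ) := by
          have : c₁ * ℓ * 1 ≤ c₁ * ℓ * m := mul_le_mul_of_nonneg_left hm' (by positivity)
          linarith
        rw [hexp]
        linarith

/-- **(5.7.6) ON THE TORUS, every geometric hypothesis discharged**: as `ineq576_torus_of_latticeSum`, with the torus lattice sum
evaluated for bonds with at most `N_f` per site (`S = N_f(2(1 + 2d/c₃))^d`, uniform in the volume); the hypotheses left are exactly
the two displayed on p. 290 (`|A′(b_l)| ≤ a`, `|w₅(b,b_l)| ≤ e^{−c₁r}e^{−c₂dist(b,b_l)}`) and `r(e_k)` large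
(`a·N_f(2(1 + 2d/c₃))^d ≤ e^{c₁r/4}`). [cite: BalabanImbrieJaffe1988, (5.7.6) p.290] -/
theorem ineq576_torus [DecidableEq β] (pos : β → Balaban1983to89.Site P j) (Nf : ℕ)
    (hN : ∀ y, (Finset.univ.filter fun b' => pos b' = y).card ≤ Nf) {ℓ : ℕ} (hℓ : 0 < ℓ) (x₀ : Balaban1983to89.Site P j)
    (w : β → β → ℝ) (A' : β → ℝ) (b : β) {m : ℕ} (hm : 1 ≤ m) {c₁ c₂ a : ℝ} (hc₁ : 0 < c₁) (hc₂ : 0 < c₂)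
    (hw : ∀ b', |w b b'| ≤ Real.exp (-(c₁ * ℓ)) * Real.exp (-(c₂ * (supDist x₀ (pos b') : ℝ))))
    (hA : ∀ b', |A' b'| ≤ a)
    (hlarge : a * (Nf * (2 * (1 + 2 * P.d / min (c₁ / 3) c₂)) ^ P.d) ≤ Real.exp (c₁ * ℓ / 4)) :
    Ineq576 ⟨Finset (CubeTor P j ℓ), Finset.card⟩ (wbm w A' b m (assocT pos ℓ x₀ m))
      (min (c₁ / 4) (min (c₁ / 3) c₂ / (2 * P.d))) ℓ := by
  have hc₃pos : 0 < min (c₁ / 3) c₂ := lt_min (by linarith) hc₂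
  have hS := sum_exp_neg_supDist_fiber_le_torus pos Nf hN (half_pos hc₃pos) x₀
  have hS' : ∑ b', Real.exp (-(min (c₁ / 3) c₂ / 2 * (supDist x₀ (pos b') : ℝ))) ≤
      Nf * (2 * (1 + 2 * P.d / min (c₁ / 3) c₂)) ^ P.d := by
    have h4 : (2 * (1 + (P.d : ℝ) / (min (c₁ / 3) c₂ / 2))) = 2 * (1 + 2 * P.d / min (c₁ / 3) c₂) := by
      rw [div_div_eq_mul_div]; ring
    rw [← h4]
    exact hS
  exact ineq576_torus_of_latticeSum pos hℓ x₀ w A' b hm hc₁ hc₂ hw hA hS' hlarge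

/-- **(5.7.6) for the unit bonds of `T^{(j)}` themselves** (`b, b₁, …, b_m ∈ T^{(k)}`, positions = initial points, `x₀ = b₋`, `N_f = d`).
[cite: BalabanImbrieJaffe1988, (5.7.6) p.290] -/
theorem ineq576_torus_bonds {ℓ : ℕ} (hℓ : 0 < ℓ) (w : Balaban1983to89.PBond P j → Balaban1983to89.PBond P j → ℝ) (A' : Balaban1983to89.PBond P j → ℝ) (b : Balaban1983to89.PBond P j)
    {m : ℕ} (hm : 1 ≤ m) {c₁ c₂ a : ℝ} (hc₁ : 0 < c₁) (hc₂ : 0 < c₂)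
    (hw : ∀ b', |w b b'| ≤ Real.exp (-(c₁ * ℓ)) * Real.exp (-(c₂ * (supDist b.src b'.src : ℝ))))
    (hA : ∀ b', |A' b'| ≤ a)
    (hlarge : a * (P.d * (2 * (1 + 2 * P.d / min (c₁ / 3) c₂)) ^ P.d) ≤ Real.exp (c₁ * ℓ / 4)) :
    Ineq576 ⟨Finset (CubeTor P j ℓ), Finset.card⟩ (wbm w A' b m (assocT Balaban1983to89.PBond.src ℓ b.src m))
      (min (c₁ / 4) (min (c₁ / 3) c₂ / (2 * P.d))) ℓ := by
  classical
  exact ineq576_torus Balaban1983to89.PBond.src P.d card_fiber_src_le hℓ b.src w A' b hm hc₁ hc₂ hw hA hlarge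

end Torus

/-! ## §3 Knitting with (5.4.9): from the one-letter `w₅` bound to (5.7.6) on the torus -/

section Knit

variable {P : Params} {j : ℕ} {β : Type} [Fintype β] [DecidableEq β]

/-- **FROM r16's ONE-LETTER SHAPE OF THE `w₅` BOUND TO (5.7.6)**: if `|w(b,b′)| ≤ e^{−cr}e^{−c·supDist(pos b, pos b′)}` (r16's
`Ineq547 β β w dist c r`, the hypothesis `hw` of p36 at `c₁ = c₂ = c`) with `r ≥ ℓ`, `|A′| ≤ a`, and `r(e_k)` large
(`a·N_f(2(1 + 6d/c))^d ≤ e^{cℓ/4}`), then `|w_{b,m}(X)| ≤ e^{−(c/(6d))ℓ|X|}` on the torus (`min(c/4, (c/3)/(2d)) = c/(6d)` for `d ≥ 1`).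
[cite: BalabanImbrieJaffe1988, (5.7.6) p.290] -/
theorem ineq576_torus_of_ineq547 (pos : β → Balaban1983to89.Site P j) (Nf : ℕ)
    (hN : ∀ y, (Finset.univ.filter fun b' => pos b' = y).card ≤ Nf) {ℓ : ℕ} (hℓ : 0 < ℓ)
    (w : β → β → ℝ) (A' : β → ℝ) (b : β) {m : ℕ} (hm : 1 ≤ m) {c rk a : ℝ} (hc : 0 < c) (hrk : (ℓ : ℝ) ≤ rk)
    (h547 : Ineq547 β β w (fun b b' => (supDist (pos b) (pos b') : ℝ)) c rk) (hA : ∀ b', |A' b'| ≤ a)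
    (hlarge : a * (Nf * (2 * (1 + 6 * P.d / c)) ^ P.d) ≤ Real.exp (c * ℓ / 4)) :
    Ineq576 ⟨Finset (CubeTor P j ℓ), Finset.card⟩ (wbm w A' b m (assocT pos ℓ (pos b) m)) (c / (6 * P.d)) ℓ := by
  have hd : 0 < P.d := lt_of_lt_of_le Nat.zero_lt_one P.hd
  have hdpos : (0 : ℝ) < P.d := by exact_mod_cast hd
  have hd1 : (1 : ℝ) ≤ P.d := by exact_mod_cast P.hd
  -- the one-letter bound gives `hw` with c₁ = c₂ = c (e^{-c rk} ≤ e^{-c ℓ})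
  have hw : ∀ b', |w b b'| ≤ Real.exp (-(c * ℓ)) * Real.exp (-(c * (supDist (pos b) (pos b') : ℝ))) := by
    intro b'
    refine (h547 b b').trans (mul_le_mul_of_nonneg_right ?_ (Real.exp_pos _).le)
    exact Real.exp_le_exp.mpr (neg_le_neg (mul_le_mul_of_nonneg_left hrk hc.le))
  have hmin : min (c / 3) c = c / 3 := min_eq_left (by linarith)
  have hlarge' : a * (Nf * (2 * (1 + 2 * P.d / min (c / 3) c)) ^ P.d) ≤ Real.exp (c * ℓ / 4) := by
    rw [hmin]
    have h6 : 2 * (P.d : ℝ) / (c / 3) = 6 * P.d / c := by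
      rw [div_div_eq_mul_div]; ring
    rw [h6]; exact hlarge
  have h := ineq576_torus pos Nf hN hℓ (pos b) w A' b hm hc hc hw hA hlarge'
  rw [hmin] at h
  -- min (c/4) ((c/3)/(2d)) = c/(6d)
  have hc6 : c / 3 / (2 * (P.d : ℝ)) = c / (6 * P.d) := by
    rw [div_div]; ring
  have hle : c / (6 * (P.d : ℝ)) ≤ c / 4 := by
    rw [div_le_div_iff₀ (by positivity) (by norm_num)]
    nlinarith
  rw [hc6, min_eq_right hle] at h
  exact h

open BIJ88Sect2Statements (Close)
open BIJ88Sect5StatementsPart3 (w5)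

/-- **(5.7.6) FOR THE KERNEL `w₅` OF (5.4.9)** (p. 283: `w₅ = [(𝒟_k − 𝒟_{k,loc})∂*Q^{e*}_k∂ + H_k − H_{k,loc}]Λ₃^{(k)*}`, *"another small,
exponentially decaying kernel"*) in p08's kernel ring `Matrix ι ι ℝ` with the index set `ι` placed on the torus `T^{(j)}` by `pos`
(at most `N_f` per site) and `dist = supDist` of the positions: p08's `BIJ88W5Bound549.ineq547_w5` (its displayed hypotheses verbatim —
the p. 282 tail bound `|(𝒟_k − 𝒟_{k,loc})(x,y)| ≤ Fe^{−δ dist₂(x,y)}`, the local factor `∂*Q^{e*}_k∂` (columns `≤ q`, glue `ρ`), (2.7)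
`|H_{k,loc} − H_k| ≤ εe^{−c₇ dist}`, `|χ₃| ≤ 1`, the absorption `Fqe^{δρ} + ε ≤ e^{−c″ℓ}`, `c″ ≤ min(δ, c₇)`) knitted with
`ineq576_torus_of_ineq547`: for `|A′| ≤ a` and `r(e_k)` large, `|w_{b,m}(X)| ≤ e^{−(c″/(6d))ℓ|X|}` for the localized powers of `w₅A′`
on the torus polymers. [cite: BalabanImbrieJaffe1988, (5.7.6) p.290] -/
theorem ineq576_torus_w5 (pos : β → Balaban1983to89.Site P j) (Nf : ℕ) (hN : ∀ y, (Finset.univ.filter fun b' => pos b' = y).card ≤ Nf)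
    {ℓ : ℕ} (hℓ : 0 < ℓ) (Dk Dloc ds Qes dm Hk Hloc : Matrix β β ℝ) (χ₃ : β → ℝ) {dist₂ : β → β → ℝ}
    {F δ q ρ ε c₇ c'' : ℝ} (hF : 0 ≤ F) (hδ : 0 ≤ δ) (hε : 0 ≤ ε) (hc'' : 0 < c'')
    (htail : ∀ x y, |(Dk - Dloc) x y| ≤ F * Real.exp (-(δ * dist₂ x y)))
    (hXcol : ∀ b, ∑ y, |(ds * Qes * dm) y b| ≤ q)
    (hXglue : ∀ x y b, (ds * Qes * dm) y b ≠ 0 → (supDist (pos x) (pos b) : ℝ) ≤ dist₂ x y + ρ)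
    (h27 : Close (fun x b => (supDist (pos x) (pos b) : ℝ)) Hloc Hk ε c₇) (hχ : ∀ b, |χ₃ b| ≤ 1)
    (habs : F * q * Real.exp (δ * ρ) + ε ≤ Real.exp (-(c'' * ℓ))) (hcδ : c'' ≤ δ) (hc₇ : c'' ≤ c₇)
    (A' : β → ℝ) (b : β) {m : ℕ} (hm : 1 ≤ m) {a : ℝ} (hA : ∀ b', |A' b'| ≤ a)
    (hlarge : a * (Nf * (2 * (1 + 6 * P.d / c'')) ^ P.d) ≤ Real.exp (c'' * ℓ / 4)) :
    Ineq576 ⟨Finset (CubeTor P j ℓ), Finset.card⟩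
      (wbm (fun x b' => w5 Dk Dloc ds Qes dm Hk Hloc (Matrix.diagonal χ₃) x b') A' b m (assocT pos ℓ (pos b) m))
      (c'' / (6 * P.d)) ℓ := by
  have hd : ∀ x b : β, 0 ≤ (supDist (pos x) (pos b) : ℝ) := fun _ _ => Nat.cast_nonneg _
  have h547 := BIJ88W5Bound549.ineq547_w5 Dk Dloc ds Qes dm Hk Hloc χ₃ (rk := (ℓ : ℝ)) hF hδ hε hd htail hXcol hXglue h27 hχ
    habs hcδ hc₇
  exact ineq576_torus_of_ineq547 pos Nf hN hℓ _ A' b hm hc'' le_rfl h547 hA hlarge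

end Knit

/-! ## §4 The fine-lattice source bond: `b ∈ T_η`, `b₁, …, b_m ∈ T^{(k)}` (the two carriers and the distance `distEU` of the torus
files of record) -/

section Fine

variable {P : Params} {k : ℕ}

open BIJ85Ineq722Torus (ctr distEU supDist_ctr_ctr supDist_triangle supDist_ctr_blk_le)
open Balaban1983to89.B5Eq118OneStroke (iterBlockOf)
open Balaban1983to89.B3TorusRadialSums (supDist_comm)

/-- the `k`-block `x_k` of a fine site `x ∈ T_η` is within `|x − y| + ½` of every unit site `y ∈ T^{(k)}` in the unit of `T^{(k)}`
(`|x − y|` = `BIJ85Ineq722Torus.distEU`, the distance of the torus files of record; through the centre of `B^k(x_k)`,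
`BIJ85Ineq722Torus.supDist_ctr_ctr`/`supDist_ctr_blk_le`). [cite: BalabanImbrieJaffe1988, (5.7.6) p.290] -/
theorem supDist_blk_le_distEU (hk : k ≤ P.m + P.K) (x : Balaban1983to89.Site P 0) (y : Balaban1983to89.Site P k) :
    (supDist (iterBlockOf k x) y : ℝ) ≤ distEU P k x y + 1 / 2 := by
  have h1 : P.L ^ k * supDist (iterBlockOf k x) y ≤ (P.L ^ k - 1) / 2 + supDist x (ctr k y) := by
    rw [← supDist_ctr_ctr hk]
    have t := supDist_triangle (ctr k (iterBlockOf k x)) x (ctr k y)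
    have c := supDist_ctr_blk_le hk x
    rw [supDist_comm] at c
    omega
  have hL : (0 : ℝ) < (P.L : ℝ) ^ k := pow_pos P.cast_L_pos k
  have hLk : (1 : ℝ) ≤ (P.L : ℝ) ^ k := by exact_mod_cast Nat.one_le_pow k P.L P.L_pos
  have h2 : ((P.L ^ k : ℕ) : ℝ) * (supDist (iterBlockOf k x) y : ℝ) ≤ (((P.L ^ k - 1) / 2 : ℕ) : ℝ) + (supDist x (ctr k y) : ℝ) := by
    exact_mod_cast h1
  have h3 : (((P.L ^ k - 1) / 2 : ℕ) : ℝ) * 2 ≤ ((P.L ^ k : ℕ) : ℝ) := by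
    have : ((P.L ^ k - 1) / 2) * 2 ≤ P.L ^ k := by omega
    exact_mod_cast this
  rw [Nat.cast_pow] at h2 h3
  unfold distEU
  rw [div_add' _ _ _ hL.ne', le_div_iff₀ hL]
  nlinarith

/-- **(5.7.6) WITH `b ∈ T_η` AND `b₁, …, b_m ∈ T^{(k)}` ON THE TORI OF RECORD**: a kernel `w : T_η × T^{(k)}-bonds → ℝ` obeying r16's
one-letter shape `Ineq547 (Site P 0) (PBond P k) w dist c r` with the distance `dist(x,b′) = distEU P k x b′₋` of the torus files of
record (p. 290 `|w₅(b,b_l)| ≤ e^{−cr(e_k)}e^{−c dist(b,b_l)}`, `r ≥ ℓ`), `|A′| ≤ a`, and `r(e_k)` large (`a·d(2(1 + 12d/c))^d ≤ e^{cℓ/8}`):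
the localized powers of `(wA′)` at the fine source `x` (r16's `wbm` with the row `b′ ↦ w(x,b′)`; the association `assocT` of the unit bonds
by their initial points, `x₀ = x_k` the `k`-block of `x`) satisfy `|w_{x,m}(X)| ≤ e^{−(c/(12d))ℓ|X|}` on the torus polymers — the block
of `x` is within `½` of `x` (`supDist_blk_le_distEU`), which halves `c₁`. [cite: BalabanImbrieJaffe1988, (5.7.6) p.290] -/
theorem ineq576_torus_fine (hk : k ≤ P.m + P.K) {ℓ : ℕ} (hℓ : 0 < ℓ) (x : Balaban1983to89.Site P 0)
    (w : Balaban1983to89.Site P 0 → Balaban1983to89.PBond P k → ℝ) (A' : Balaban1983to89.PBond P k → ℝ)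
    (b₀ : Balaban1983to89.PBond P k) {m : ℕ} (hm : 1 ≤ m) {c rk a : ℝ} (hc : 0 < c) (hrk : (ℓ : ℝ) ≤ rk)
    (h547 : Ineq547 (Balaban1983to89.Site P 0) (Balaban1983to89.PBond P k) w (fun x b' => distEU P k x b'.src) c rk)
    (hA : ∀ b', |A' b'| ≤ a)
    (hlarge : a * (P.d * (2 * (1 + 12 * P.d / c)) ^ P.d) ≤ Real.exp (c * ℓ / 8)) :
    Ineq576 ⟨Finset (CubeTor P k ℓ), Finset.card⟩
      (wbm (fun _ b' => w x b') A' b₀ m (assocT Balaban1983to89.PBond.src ℓ (iterBlockOf k x) m)) (c / (12 * P.d)) ℓ := by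
  classical
  have hd : 0 < P.d := lt_of_lt_of_le Nat.zero_lt_one P.hd
  have hdpos : (0 : ℝ) < P.d := by exact_mod_cast hd
  have hℓ1 : (1 : ℝ) ≤ ℓ := by exact_mod_cast hℓ
  -- the kernel bound seen from the block x_k of x: c₁ = c/2, c₂ = c
  have hw : ∀ b' : Balaban1983to89.PBond P k, |(fun _ b' => w x b') b₀ b'| ≤
      Real.exp (-(c / 2 * ℓ)) * Real.exp (-(c * (supDist (iterBlockOf k x) b'.src : ℝ))) := by
    intro b'
    have h1 := h547 x b'
    have h2 := supDist_blk_le_distEU hk x b'.src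
    dsimp only at h1 ⊢
    refine h1.trans ?_
    rw [← Real.exp_add, ← Real.exp_add, Real.exp_le_exp]
    nlinarith
  have hmin : min (c / 2 / 3) c = c / 6 := by rw [min_eq_left (by linarith)]; ring
  have hlarge' : a * (P.d * (2 * (1 + 2 * P.d / min (c / 2 / 3) c)) ^ P.d) ≤ Real.exp (c / 2 * ℓ / 4) := by
    rw [hmin]
    have h6 : 2 * (P.d : ℝ) / (c / 6) = 12 * P.d / c := by
      rw [div_div_eq_mul_div]; ring
    have h8 : c / 2 * (ℓ : ℝ) / 4 = c * ℓ / 8 := by ring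
    rw [h6, h8]; exact hlarge
  have h := ineq576_torus Balaban1983to89.PBond.src P.d card_fiber_src_le hℓ (iterBlockOf k x) (fun _ b' => w x b') A' b₀ hm
    (half_pos hc) hc hw hA hlarge'
  rw [hmin] at h
  have hc12 : c / 6 / (2 * (P.d : ℝ)) = c / (12 * P.d) := by
    rw [div_div]; ring
  have hd1 : (1 : ℝ) ≤ P.d := by exact_mod_cast P.hd
  have hle : c / (12 * (P.d : ℝ)) ≤ c / 2 / 4 := by
    rw [div_div, div_le_div_iff₀ (by positivity) (by norm_num)]
    nlinarith
  rw [hc12, min_eq_right hle] at h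
  exact h

end Fine

/-! ## §5 The small-coupling regime (2.3)/(2.33): «r(e_k) large» discharged as `e_k → 0⁺` -/

section Eventually

variable {P : Params} {j : ℕ} {β : Type*} [Fintype β] [DecidableEq β]

open BIJ88Sect2Statements (rLen pLog)
open BIJ88SmallCoupling23 (tendsto_abs_log_inv eventually_hlarge576)
open Filter Topology

/-- **(5.7.6) ON THE TORUS FOR ALL SUFFICIENTLY SMALL `e_k`** (p. 290: the logarithmic growth `|A′(b_l)| ≤ cp(e_k)` of (2.33) is
absorbed by `e^{−cr(e_k)}`, `r(e_k) = |log e_k⁻¹|^r` (2.3)): for families `w(e_k)`, `A′(e_k)` with `|w(e_k)(b,b′)| ≤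
e^{−c₁⌈r(e_k)⌉}e^{−c₂·supDist(x₀,b′)}` and `|A′(e_k)(b′)| ≤ c_A·p(e_k)`, the cube side `ℓ = ⌈r(e_k)⌉` and the constants of
`ineq576_torus`, the hypothesis *"r(e_k) large"* holds eventually (p36's `BIJ88SmallCoupling23.eventually_hlarge576`), so
`Ineq576` holds for every `e_k` in a punctured right neighbourhood of `0`. [cite: BalabanImbrieJaffe1988, (5.7.6) p.290] -/
theorem ineq576_torus_eventually (pos : β → Balaban1983to89.Site P j) (Nf : ℕ)
    (hN : ∀ y, (Finset.univ.filter fun b' => pos b' = y).card ≤ Nf) (x₀ : Balaban1983to89.Site P j)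
    (w : ℝ → β → β → ℝ) (A' : ℝ → β → ℝ) (b : β) {m : ℕ} (hm : 1 ≤ m) {c₁ c₂ cA p r : ℝ}
    (hc₁ : 0 < c₁) (hc₂ : 0 < c₂) (hr : 0 < r)
    (hw : ∀ ek b', |w ek b b'| ≤
      Real.exp (-(c₁ * ((⌈rLen r ek⌉₊ : ℕ) : ℝ))) * Real.exp (-(c₂ * (supDist x₀ (pos b') : ℝ))))
    (hA : ∀ ek b', |A' ek b'| ≤ cA * pLog p ek) :
    ∀ᶠ ek in 𝓝[>] (0 : ℝ),
      Ineq576 ⟨Finset (CubeTor P j ⌈rLen r ek⌉₊), Finset.card⟩ (wbm (w ek) (A' ek) b m (assocT pos ⌈rLen r ek⌉₊ x₀ m))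
        (min (c₁ / 4) (min (c₁ / 3) c₂ / (2 * P.d))) ((⌈rLen r ek⌉₊ : ℕ) : ℝ) := by
  have hM := eventually_hlarge576 cA ((Nf : ℝ) * (2 * (1 + 2 * P.d / min (c₁ / 3) c₂)) ^ P.d) c₁ p r hc₁ hr
  have h1 : ∀ᶠ ek : ℝ in 𝓝[>] 0, 1 ≤ |Real.log ek⁻¹| := tendsto_abs_log_inv.eventually (eventually_ge_atTop 1)
  filter_upwards [hM, h1] with ek hlarge hlog
  have hrpos : 0 < rLen r ek := by
    unfold rLen
    exact Real.rpow_pos_of_pos (by linarith) r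
  have hℓ : 0 < ⌈rLen r ek⌉₊ := Nat.ceil_pos.mpr hrpos
  refine ineq576_torus pos Nf hN hℓ x₀ (w ek) (A' ek) b hm hc₁ hc₂ (hw ek) (hA ek) ?_
  -- c_A p(e_k) M ≤ e^{c₁ r(e_k)/4} ≤ e^{c₁ ⌈r(e_k)⌉/4}
  refine hlarge.trans (Real.exp_le_exp.mpr ?_)
  have hc : c₁ * rLen r ek ≤ c₁ * ((⌈rLen r ek⌉₊ : ℕ) : ℝ) := mul_le_mul_of_nonneg_left (Nat.le_ceil _) hc₁.le
  linarith

end Eventually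

end

end Literature.MathematicalPhysics.QuantumFieldTheory.BalabanImbrieJaffe1984to88.BIJ88Ineq576Torus
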